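import Summits.QuantumFields.YangMills.Theorems.BalabanUVNodesN21ShellSplitOfRecord13CoPHChartKeyed
import Summits.QuantumFields.BalabanUV.T4Continuum.Support.ShellMeasureScalingLocal

/-!
# N21 (NE7c) · JUNCTION №5 — THE CHART ROAD IN A TREE GAUGE (repairs (R1)+(R2) of the seat's LOCATED-1, certificate p612378): dag-n21-d's END at the reading of record
# from per-cube data `(T, U₀, b)` — a loop-free TREE gauge, a BLOCK of the prover's choice (e.g. `inputBlock a ∖ T`) — and per-exterior-field chart packages for the
# GAUGE-FIXED block fibre laws `(∏_b Haar).withDensity (y ↦ (cubeDensityOfDatum₉ … ∘ fixTo T U₀) (x ⊕ y))`, whose densities CAN be carried by a window about a fixed centre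

Track A of `YM-PLAN.md` (cell `pub-ymgap`, HUMAN RULING D-0062 ∕ D-0149 width seats), node **N21**; WIDTH SEAT `pub-ymgap-dag-n21-w2` (gen 2), file 19.  THEOREMS ONLY: 0 `def`, 0 `sorry`;
COUNT-NEUTRAL; `--kind proof --supports stmt-QuantumFields-20544 --as helper`.  Imports my socket `…ChartKeyed` (p605800; → `…StatDilation` → dag-n21-d's FILE 6 `…Stat` ★★★★ road, FILE 5's generic
`withDensity_pi_apply_le_of_lmarginal`, pub-balaban's chart modules) and pub-balaban's `Support/ShellMeasureScalingLocal` (§3 `slotAntiConcentration_gaugeFixed_iff`, `T4TreeGaugeFixing.fixTo`).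
NO Theses import.  Restates nothing; cites by name.

WHY.  LOCATED-1 (bus 2026-08-28 06:58Z; kernel certificate p612378 `blockFibreLawOfDatum₉_eq_zero_of_window_of_siteInvariant`): at a block holding every bond of a site, the window
letter `hlaw` of junction №3 and the printed gauge invariance of the dressed density are inhabited only by the zero fibre law.  Print's cure is the tree (axial) gauge on the
localization cube ([LF-II] §1; pub-balaban `ShellMeasureScalingLocal` §3: «the window factorisation … is to be asked of `F ∘ fixTo T U₀`»).  This file re-keys the chart road accordingly:
(i) (M1) for the cube law ⟺ (M1) for the tree-gauge-fixed density (pub-balaban, given gauge invariance of density and statistic — LETTERS); (ii) a GENERIC block disintegration of (M1)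
for ANY density on the field measure along ANY block `b` (the prover takes `b` disjoint from `T`, so that no fibre coordinate is a dummy); (iii) per exterior field the chart socket of
p605800 §1 for the WINDOWED law itself.  The window letter is now asked of the gauge-fixed fibre density — satisfiable in principle (small fields ARE near the background in the tree gauge).

WHAT IS PROVED ([bookkeeping] + [folklore] Tonelli).
* §1 ★ `slotAntiConcentration_withDensity_of_blockFibres` — GENERIC block disintegration: for a measurable density `Gd` on `GaugeField P j (SU N)`, a block `b`, a measurable statistic `u`:
  (M1) for every block fibre law `(∏_b Haar).withDensity (y ↦ Gd (x ⊕ y))` along `y ↦ u (x ⊕ y)` ⇒ (M1) for `(fieldMeasure).withDensity Gd` along `u`, same constants.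
* §2 `windowLawAC_of_chartLawAC` — p605800 §1 for the windowed law `(blockLaw b).withDensity (windowSU b c S · R)` itself (no law identity): `hread` on the window + `hdens` + cut-chart-law
  (M1) ⇒ (M1) along any measurable `v`.
* §3 ★★ `shellWeightBound_crOfRecord₁₃At_shellSplit_of_treeGaugeChartLaws` — dag-n21-d's END at `crOfRecord₁₃At K₀ jcut (shellSplitOfRecord₁₃At N K₀ ρA ρB)` from the usual rows and, per
  (run, K, `|t| ≤ 1`, top cube `a`), an ∃-package `(T, U₀, b)`: `NoClosedLoop T`, gauge invariance of the cube density and of `cubeStat a` (LETTERS, printed), and FOR EVERY exterior field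
  `x` a chart package `(S, c, R, U, A, f, D)` for the GAUGE-FIXED block fibre law along `b`: window factorisation, `MeasurableSet A`, `Measurable R`, `0 ≤ S ≤ π`, the reading of
  `cubeStat a ∘ fixTo T U₀` in the chart on the window, `hdens`, cut-chart-law (M1) below `ε_k` at width `ρ_K`, `D ≤ D_K` (★★★★'s road `…_of_liveSel ∘ cubeAC_of_slotAntiConcentration`,
  then `cubeLawOfDatum₉_eq_withDensity` + `slotAntiConcentration_gaugeFixed_iff` + §1 + §2 + `slotAntiConcentration_mono`) · `…VAt…` V edition.

HONEST FRAMING.  The gauge invariances (cube density, cube statistic), the per-fibre window factorisation of the GAUGE-FIXED density, the density presentation, the reading identity and the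
cut-chart-law (M1) are HYPOTHESES (located letters: printed gauge invariance; small-field windows in the tree gauge; [LF-II]-§1 rows via dag-n21-w1's producers at `v := y ↦ (cubeStat a ∘
fixTo T U₀)(x ⊕ y)`; NODE O's term object) — inhabited for no family here; `hsel`, (H-U), (H-ζ), `0 ≤ ζ`, widths, `D_K`, `jcut`, `T`, `U₀`, `b` free ∕ displayed; K0⁷ OPEN; nothing of
Bałaban's asserted; NE7c NOT PRINTED ∕ NOT proved; **N21 NOT discharged**; K3⁷ NOT claimed; counts UNMOVED (typed 28∕28 · discharged 5∕27); one finite four-torus programme at fixed `ε` —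
NOT ℝ⁴, NOT infinite volume, NOT OS, NOT a mass gap, NOT Clay.  No decl below carries a cite tag.
-/

set_option autoImplicit false

open scoped BigOperators ENNReal
open Finset MeasureTheory Function Metric

namespace Summit.QuantumFields.YangMills.Theorems.N21ChartJunctionKeyed

open Literature.MathematicalPhysics.QuantumFieldTheory.Balaban1983to89
open Literature.MathematicalPhysics.QuantumFieldTheory.Balaban1983to89.T4Continuum
open Literature.MathematicalPhysics.QuantumFieldTheory.Balaban1983to89.Node00 hiding dimSU
open T4ShellMeasure (SlotAntiConcentration shell_eq_preimage)
open T4ShellMeasureDet (blockLaw blockLaw_eq_pi slotAntiConcentration_of_chart)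
open T4ShellMeasureFibre (slotAntiConcentration_mono)
open N21ShellSplitOfRecord13CoPH (withDensity_pi_apply_le_of_lmarginal)
open Summit.QuantumFields.BalabanUV.T4Continuum.ShellMeasureRootCompositionLevelZero (slotAntiConcentration_congr_offNull)
open Summit.QuantumFields.BalabanUV.T4Continuum.ShellMeasureExpChartSUN
  (SUN BlockChartSU expFibreChartSU measurable_expFibreChartSU chartWeightSU measurable_chartWeightSU)
open Summit.QuantumFields.BalabanUV.T4Continuum.ShellMeasureScalingSUN (windowSU measurable_windowSU chart_suN)
open Summit.QuantumFields.BalabanUV.T4Continuum.ShellMeasureExpJacobianSUN (expJacWeightSU measurable_expJacWeightSU)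
open Summit.QuantumFields.BalabanUV.T4Continuum.ShellMeasureExpHaarAreaSUN (kappaSU)
open Summit.QuantumFields.BalabanUV.T4Continuum.ShellMeasureExpHaarClosedBallSUN (haar_restrict_expBallSU_le)

/-! ## §1 Generic block disintegration of (M1) for a density on the field measure -/

section Disintegration

variable {P : Params} {j : ℕ} {N : ℕ} [NeZero N]

/-- ★ **BLOCK DISINTEGRATION OF (M1), ANY DENSITY.**  For a measurable density `Gd` on the level-`j` gauge fields, a finite bond block `b` and a measurable statistic `u`: if at EVERY
exterior field `x` the block fibre law `(∏_b Haar).withDensity (y ↦ Gd (x ⊕ y))` anti-concentrates `y ↦ u (x ⊕ y)` (constants `θ ρ D`), then `(fieldMeasure).withDensity Gd`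
anti-concentrates `u`, same constants (dag-n21-d FILE 5's `withDensity_pi_apply_le_of_lmarginal` BY NAME; the fibre integrals are `MeasureTheory.lmarginal` at `x`). [folklore] -/
theorem slotAntiConcentration_withDensity_of_blockFibres (Gd : GaugeField P j (SUN N) → ℝ≥0∞) (hG : Measurable Gd) (b : Finset (PBond P j))
    {u : GaugeField P j (SUN N) → ℝ} (hu : Measurable u) {θ ρ Dc : ℝ}
    (hfib : ∀ x : GaugeField P j (SUN N),
      SlotAntiConcentration ((Measure.pi fun _ : ↥b => (HaarData.haar : Measure (SUN N))).withDensity fun y => Gd (Function.updateFinset x b y))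
        (fun y => u (Function.updateFinset x b y)) θ ρ Dc) :
    SlotAntiConcentration ((fieldMeasure P j (SUN N)).withDensity Gd) u θ ρ Dc := by
  have hS : MeasurableSet {V : GaugeField P j (SUN N) | θ * (1 - ρ) ≤ u V ∧ u V < θ} := by
    rw [shell_eq_preimage]; exact hu measurableSet_Ico
  unfold SlotAntiConcentration
  have hfib' : ∀ x : GaugeField P j (SUN N),
      (∫⋯∫⁻_b, {V : GaugeField P j (SUN N) | θ * (1 - ρ) ≤ u V ∧ u V < θ}.indicator Gd ∂fun _ => (HaarData.haar : Measure (SUN N))) x ≤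
        ENNReal.ofReal (Dc * ρ) * (∫⋯∫⁻_b, (Set.univ : Set (GaugeField P j (SUN N))).indicator Gd ∂fun _ => (HaarData.haar : Measure (SUN N))) x := by
    intro x
    have hSy : MeasurableSet {y : ↥b → SUN N | θ * (1 - ρ) ≤ u (Function.updateFinset x b y) ∧ u (Function.updateFinset x b y) < θ} := by
      have : MeasurableSet {y : ↥b → SUN N | Function.updateFinset x b y ∈ {V : GaugeField P j (SUN N) | θ * (1 - ρ) ≤ u V ∧ u V < θ}} :=
        measurable_updateFinset hS
      exact this
    have h := hfib x
    unfold SlotAntiConcentration at h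
    rw [withDensity_apply _ hSy, withDensity_apply _ MeasurableSet.univ, Measure.restrict_univ, ← lintegral_indicator hSy] at h
    have e1 : (∫⋯∫⁻_b, {V : GaugeField P j (SUN N) | θ * (1 - ρ) ≤ u V ∧ u V < θ}.indicator Gd ∂fun _ => (HaarData.haar : Measure (SUN N))) x =
        ∫⁻ y, {y : ↥b → SUN N | θ * (1 - ρ) ≤ u (Function.updateFinset x b y) ∧ u (Function.updateFinset x b y) < θ}.indicator
          (fun y => Gd (Function.updateFinset x b y)) y ∂(Measure.pi fun _ : ↥b => (HaarData.haar : Measure (SUN N))) := by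
      refine lintegral_congr fun y => ?_
      exact (Set.indicator_comp_right (fun y : ↥b → SUN N => (Function.updateFinset x b y : GaugeField P j (SUN N))) (g := Gd)).symm
    have e2 : (∫⋯∫⁻_b, (Set.univ : Set (GaugeField P j (SUN N))).indicator Gd ∂fun _ => (HaarData.haar : Measure (SUN N))) x =
        ∫⁻ y, Gd (Function.updateFinset x b y) ∂(Measure.pi fun _ : ↥b => (HaarData.haar : Measure (SUN N))) := by
      refine lintegral_congr fun y => ?_
      rw [Set.indicator_univ]
    rw [e1, e2]
    exact h
  exact withDensity_pi_apply_le_of_lmarginal (fun _ : PBond P j => (HaarData.haar : Measure (SUN N))) hG b hS MeasurableSet.univ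
    (ENNReal.ofReal (Dc * ρ)) hfib'

end Disintegration

/-! ## §2 Generic chart socket for a WINDOWED block law -/

section Window

variable {P : Params} {j : ℕ} {N : ℕ} [NeZero N]

/-- Transport of `SlotAntiConcentration` along an equality of laws (unification-friendly form of `h ▸ ·`). [bookkeeping] -/
theorem slotAntiConcentration_of_law_eq {α : Type*} [MeasurableSpace α] {μ ν : Measure α} (h : μ = ν) {u : α → ℝ} {θ ρ D : ℝ}
    (hν : SlotAntiConcentration ν u θ ρ D) : SlotAntiConcentration μ u θ ρ D := h ▸ hν

/-- **(M1) FOR A WINDOWED BLOCK LAW FROM (M1) FOR ITS CUT CHART LAW** (p605800 §1 without the law identity): for the law `(blockLaw b).withDensity (windowSU b c S · R)` (`0 ≤ S ≤ π`,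
`R` measurable), a measurable statistic `v` reading `U` in the chart on the window, `hdens`, and (M1) for `(vol.withDensity f)|A` along `U` ⇒ (M1) for the windowed law along `v`. [bookkeeping] -/
theorem windowLawAC_of_chartLawAC (b : Finset (PBond P j)) {S : ℝ} (hS : 0 ≤ S) (hSπ : S ≤ Real.pi) (c : GaugeField P j (SUN N))
    {R : (↥b → SUN N) → ℝ≥0∞} (hR : Measurable R) {v : (↥b → SUN N) → ℝ} (hv : Measurable v)
    {U : BlockChartSU N b → ℝ} {A : Set (BlockChartSU N b)} (hA : MeasurableSet A) {f : BlockChartSU N b → ℝ≥0∞}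
    (hread : ∀ z ∈ closedBall (0 : BlockChartSU N b) S, v (expFibreChartSU b c z) = U z)
    (hdens : (fun z : BlockChartSU N b => chartWeightSU b S (expJacWeightSU (kappaSU N)) z * R (expFibreChartSU b c z)) =ᵐ[volume] A.indicator f)
    {θ ρ D : ℝ} (hchart : SlotAntiConcentration (((volume : Measure (BlockChartSU N b)).withDensity f).restrict A) U θ ρ D) :
    SlotAntiConcentration ((blockLaw b).withDensity fun y => windowSU b c S y * R y) v θ ρ D := by
  have h1 : SlotAntiConcentration ((volume : Measure (BlockChartSU N b)).withDensity fun z =>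
      chartWeightSU b S (expJacWeightSU (kappaSU N)) z * R (expFibreChartSU b c z)) U θ ρ D := by
    rw [restrict_withDensity hA, ← withDensity_indicator hA, ← withDensity_congr_ae hdens] at hchart
    exact hchart
  have hform : (fun z : BlockChartSU N b => chartWeightSU b S (expJacWeightSU (kappaSU N)) z * R (expFibreChartSU b c z)) =
      (closedBall (0 : BlockChartSU N b) S).indicator
        fun z => (∏ i, expJacWeightSU (kappaSU N) (z i)) * R (expFibreChartSU b c z) := by
    funext z
    show (closedBall (0 : BlockChartSU N b) S).indicator (fun z' => ∏ i, expJacWeightSU (kappaSU N) (z' i)) z *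
        R (expFibreChartSU b c z) = _
    exact (Set.indicator_mul_left (closedBall (0 : BlockChartSU N b) S)
      (fun z' => ∏ i, expJacWeightSU (kappaSU N) (z' i)) fun z' => R (expFibreChartSU b c z')).symm
  rw [hform] at h1
  have h2 : SlotAntiConcentration ((volume : Measure (BlockChartSU N b)).withDensity
      ((closedBall (0 : BlockChartSU N b) S).indicator
        fun z => (∏ i, expJacWeightSU (kappaSU N) (z i)) * R (expFibreChartSU b c z)))
      (v ∘ expFibreChartSU b c) θ ρ D :=
    slotAntiConcentration_congr_offNull volume measurableSet_closedBall (fun z hz => Set.indicator_of_notMem hz _)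
      (fun z hz => hread z hz) h1
  rw [← hform] at h2
  exact slotAntiConcentration_of_chart (blockLaw b) volume (measurable_expFibreChartSU b c)
    (measurable_chartWeightSU b S (measurable_expJacWeightSU (kappaSU N))) (measurable_windowSU b c S)
    (chart_suN b c hS (measurable_expJacWeightSU (kappaSU N)) (haar_restrict_expBallSU_le hSπ)) hR hv h2

end Window

/-! ## §3 dag-n21-d's END FROM PER-CUBE TREE-GAUGE + PER-FIBRE CHART DATA -/

section AtRecord

open T4IndicatorShell (ShellWeightBound)
open T4TreeGaugeFixing (NoClosedLoop fixTo measurable_fixTo)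
open GaugeField (GaugeInvariant)
open YMDAG.UVSplit (crOfRecord₁₃At crOfRecord₁₃VAt ShellSplit₁₃CoPH runA₁₃ runB₁₃ histA₁₃ histB₁₃)
open Summit.QuantumFields.YangMills.Theorems.N21ShellSplitOfRecord13CoPH
open Summit.QuantumFields.YangMills.BalabanUVNodes.N19MGFFormAtRecord (wOfRecord₉_nonneg)
open Summit.QuantumFields.BalabanUV.T4Continuum.ShellMeasureScalingLocal (slotAntiConcentration_gaugeFixed_iff)
open N21DilationRoadAtRecord13CoPH (shellWeightBound_crOfRecord₁₃VAt_iff_crOfRecord₁₃At)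

variable {F : T4Family} {N : ℕ} [NeZero N]

/-- ★★ **dag-n21-d's END AT THE READING OF RECORD FROM A TREE GAUGE PER CUBE AND CHART DATA PER GAUGE-FIXED BLOCK FIBRE.**  `ShellWeightBound` at
`crOfRecord₁₃At K₀ jcut (shellSplitOfRecord₁₃At N K₀ ρA ρB)` on the live-selector line from n20-d's rows (`hsel`, (H-U), (H-ζ), `0 ≤ ζ`), the widths' signs, `0 ≤ D_K`, `Σ_K D_K ρ_K < ∞`, and per
(run, K, `|t| ≤ 1`, top cube `a`) an ∃-package `(T, U₀, b)` — loop-free `T`, gauge invariance of the cube density and of the cube statistic of record (letters), a block `b` — with, FOR EVERY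
exterior field `x`, a chart package `(S, c, R, U, A, f, D)` for the GAUGE-FIXED block fibre law along `b` (window factorisation, `MeasurableSet A`, `Measurable R`, `0 ≤ S ≤ π`, the reading
of `cubeStat a ∘ fixTo T U₀` in the chart on the window, `hdens`, cut-chart-law (M1) below `ε_k` at width `ρ_K`, `D ≤ D_K`). [bookkeeping] -/
theorem shellWeightBound_crOfRecord₁₃At_shellSplit_of_treeGaugeChartLaws (K₀ : ℕ) (jcut : ℕ → ℕ) (ρA ρB : WidthLetter₁₃CoPH N) (θ : Stage13HParams F N)
    (hP : θ.Provisos₁₃CoPH F N) (g₀ : ℕ → ℝ) (os : List (ULoop F)) (E : B12.RunParams → ℝ)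
    (hsel : θ.ppSel = ppSelLiveOfRecord F N θ.ν θ.τ9 E (wOfRecord₉ F N θ.toStage9Params))
    (hU : LocalBgMeasurable F N θ.ν) (hζm : ZetaMeasurable F N θ.ζ) (hζ0 : ∀ p g k s Pl Ql RS U V', 0 ≤ θ.ζ p g k s Pl Ql RS U V')
    {DA DB : ℕ → ℝ} (hρA : ∀ K, 0 ≤ ρA F θ hP g₀ os K) (hDA : ∀ K, 0 ≤ DA K) (hρB : ∀ K, 0 ≤ ρB F θ hP g₀ os K) (hDB : ∀ K, 0 ≤ DB K)
    (hsA : Summable (fun K => DA K * ρA F θ hP g₀ os K)) (hsB : Summable (fun K => DB K * ρB F θ hP g₀ os K))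
    (htgA : ∀ (K : ℕ) (t : ℝ), |t| ≤ 1 →
      ∀ (a : ↥(cubeIndices (F.P (K₀ + K)) (cubeSide (F.P (K₀ + K)).L θ.ν.M₂ (RkOfRecord (F.P (K₀ + K)).L θ.ν.r (histA₁₃ θ K₀ g₀ K (K₀ + K))) (K₀ + K)))),
        ∃ (T : Finset (PBond (F.P (K₀ + K)) (K₀ + K))) (U₀ : GaugeField (F.P (K₀ + K)) (K₀ + K) (SU N)) (b : Finset (PBond (F.P (K₀ + K)) (K₀ + K))),
          NoClosedLoop T ∧ GaugeInvariant (cubeDensityOfDatum₉ F N θ.toStage9Params (datumOfRecord₁₃CoPH F N θ hP) g₀ os (runA₁₃ F K₀ g₀ K) (histA₁₃ θ K₀ g₀ K) (K₀ + K) t a) ∧ GaugeInvariant (cubeStat F N θ.ν (histA₁₃ θ K₀ g₀ K) (Kc := K₀ + K) (k := K₀ + K) a) ∧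
          ∀ x : GaugeField (F.P (K₀ + K)) (K₀ + K) (SU N),
            ∃ (S : ℝ) (c : GaugeField (F.P (K₀ + K)) (K₀ + K) (SU N)) (R : (↥b → SU N) → ℝ≥0∞)
              (U : BlockChartSU N b → ℝ) (A : Set (BlockChartSU N b)) (f : BlockChartSU N b → ℝ≥0∞) (D : ℝ),
              0 ≤ S ∧ S ≤ Real.pi ∧ Measurable R ∧
              (Measure.pi fun _ : ↥b => (HaarData.haar : Measure (SU N))).withDensity
                  (fun y => ((cubeDensityOfDatum₉ F N θ.toStage9Params (datumOfRecord₁₃CoPH F N θ hP) g₀ os (runA₁₃ F K₀ g₀ K) (histA₁₃ θ K₀ g₀ K) (K₀ + K) t a) ∘ fixTo T U₀) (Function.updateFinset x b y))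
                = (blockLaw b).withDensity (fun y => windowSU b c S y * R y) ∧
              MeasurableSet A ∧
              (∀ z ∈ closedBall (0 : BlockChartSU N b) S,
                ((cubeStat F N θ.ν (histA₁₃ θ K₀ g₀ K) (Kc := K₀ + K) (k := K₀ + K) a) ∘ fixTo T U₀) (Function.updateFinset x b (expFibreChartSU b c z)) = U z) ∧
              ((fun z : BlockChartSU N b => chartWeightSU b S (expJacWeightSU (kappaSU N)) z * R (expFibreChartSU b c z)) =ᵐ[volume] A.indicator f) ∧
              SlotAntiConcentration (((volume : Measure (BlockChartSU N b)).withDensity f).restrict A) U (epsOfRecord θ.ν (histA₁₃ θ K₀ g₀ K) (K₀ + K)) (ρA F θ hP g₀ os K) D ∧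
              D ≤ DA K)
    (htgB : ∀ (K : ℕ) (t : ℝ), |t| ≤ 1 →
      ∀ (a : ↥(cubeIndices (F.P (K₀ + K + 1)) (cubeSide (F.P (K₀ + K + 1)).L θ.ν.M₂ (RkOfRecord (F.P (K₀ + K + 1)).L θ.ν.r (histB₁₃ θ K₀ g₀ K (K₀ + K + 1))) (K₀ + K + 1)))),
        ∃ (T : Finset (PBond (F.P (K₀ + K + 1)) (K₀ + K + 1))) (U₀ : GaugeField (F.P (K₀ + K + 1)) (K₀ + K + 1) (SU N)) (b : Finset (PBond (F.P (K₀ + K + 1)) (K₀ + K + 1))),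
          NoClosedLoop T ∧ GaugeInvariant (cubeDensityOfDatum₉ F N θ.toStage9Params (datumOfRecord₁₃CoPH F N θ hP) g₀ os (runB₁₃ F K₀ g₀ K) (histB₁₃ θ K₀ g₀ K) (K₀ + K + 1) t a) ∧ GaugeInvariant (cubeStat F N θ.ν (histB₁₃ θ K₀ g₀ K) (Kc := K₀ + K + 1) (k := K₀ + K + 1) a) ∧
          ∀ x : GaugeField (F.P (K₀ + K + 1)) (K₀ + K + 1) (SU N),
            ∃ (S : ℝ) (c : GaugeField (F.P (K₀ + K + 1)) (K₀ + K + 1) (SU N)) (R : (↥b → SU N) → ℝ≥0∞)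
              (U : BlockChartSU N b → ℝ) (A : Set (BlockChartSU N b)) (f : BlockChartSU N b → ℝ≥0∞) (D : ℝ),
              0 ≤ S ∧ S ≤ Real.pi ∧ Measurable R ∧
              (Measure.pi fun _ : ↥b => (HaarData.haar : Measure (SU N))).withDensity
                  (fun y => ((cubeDensityOfDatum₉ F N θ.toStage9Params (datumOfRecord₁₃CoPH F N θ hP) g₀ os (runB₁₃ F K₀ g₀ K) (histB₁₃ θ K₀ g₀ K) (K₀ + K + 1) t a) ∘ fixTo T U₀) (Function.updateFinset x b y))
                = (blockLaw b).withDensity (fun y => windowSU b c S y * R y) ∧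
              MeasurableSet A ∧
              (∀ z ∈ closedBall (0 : BlockChartSU N b) S,
                ((cubeStat F N θ.ν (histB₁₃ θ K₀ g₀ K) (Kc := K₀ + K + 1) (k := K₀ + K + 1) a) ∘ fixTo T U₀) (Function.updateFinset x b (expFibreChartSU b c z)) = U z) ∧
              ((fun z : BlockChartSU N b => chartWeightSU b S (expJacWeightSU (kappaSU N)) z * R (expFibreChartSU b c z)) =ᵐ[volume] A.indicator f) ∧
              SlotAntiConcentration (((volume : Measure (BlockChartSU N b)).withDensity f).restrict A) U (epsOfRecord θ.ν (histB₁₃ θ K₀ g₀ K) (K₀ + K + 1)) (ρB F θ hP g₀ os K) D ∧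
              D ≤ DB K)
    :
    ShellWeightBound (crOfRecord₁₃At K₀ jcut (shellSplitOfRecord₁₃At N K₀ ρA ρB) F θ hP g₀ os).l₀
      (crOfRecord₁₃At K₀ jcut (shellSplitOfRecord₁₃At N K₀ ρA ρB) F θ hP g₀ os).T (crOfRecord₁₃At K₀ jcut (shellSplitOfRecord₁₃At N K₀ ρA ρB) F θ hP g₀ os).A
      (crOfRecord₁₃At K₀ jcut (shellSplitOfRecord₁₃At N K₀ ρA ρB) F θ hP g₀ os).B (crOfRecord₁₃At K₀ jcut (shellSplitOfRecord₁₃At N K₀ ρA ρB) F θ hP g₀ os).shA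
      (crOfRecord₁₃At K₀ jcut (shellSplitOfRecord₁₃At N K₀ ρA ρB) F θ hP g₀ os).shB (crOfRecord₁₃At K₀ jcut (shellSplitOfRecord₁₃At N K₀ ρA ρB) F θ hP g₀ os).Wsh := by
  have hD : (datumOfRecord₁₃CoPH F N θ hP).AvgMeasurable := (isPrintedAveraged_datumOfRecord₁₃CoPH F N θ hP).avgMeasurable
  have hw0 : ∀ (p : B12.RunParams) (g : ℕ → ℝ) k s' U V', 0 ≤ wOfRecord₉ F N θ.toStage9Params p g k s' U V' :=
    fun p g => wOfRecord₉_nonneg θ.toStage9Params hζ0 p g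
  refine shellWeightBound_crOfRecord₁₃At_shellSplit_of_liveSel K₀ jcut ρA ρB θ hP g₀ os E hsel hU hζm hζ0 hρA hDA hρB hDB hsA hsB
    (fun K t ht a => ?_) (fun K t ht a => ?_)
  · refine cubeAC_of_slotAntiConcentration F N θ.toStage9Params (datumOfRecord₁₃CoPH F N θ hP) g₀ os (runA₁₃ F K₀ g₀ K) (histA₁₃ θ K₀ g₀ K) (K₀ + K)
      hU (hw0 _ _) (hρA K) t a (fun s => integrable_topPieceA_of_liveSel K₀ θ hP E hsel hU hζm hζ0 g₀ os K t s)
      (cubeStat F N θ.ν (histA₁₃ θ K₀ g₀ K) (Kc := K₀ + K) (k := K₀ + K) a)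
      (fun V => cubeStat_lt_iff F N θ.ν (histA₁₃ θ K₀ g₀ K) (K₀ + K) (K₀ + K) a (plaqInside_cubeEnl_nonempty F θ.ν _ _ _ a) _ V)
      (fun V => cubeStat_lt_iff F N θ.ν (histA₁₃ θ K₀ g₀ K) (K₀ + K) (K₀ + K) a (plaqInside_cubeEnl_nonempty F θ.ν _ _ _ a) _ V) (hDA K) ?_
    obtain ⟨T, U₀, b, hT, hFi, hui, hx⟩ := htgA K t ht a
    have hGm : Measurable (cubeDensityOfDatum₉ F N θ.toStage9Params (datumOfRecord₁₃CoPH F N θ hP) g₀ os (runA₁₃ F K₀ g₀ K) (histA₁₃ θ K₀ g₀ K) (K₀ + K) t a) :=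
      measurable_cubeDensityOfDatum₉ F N θ.toStage9Params (datumOfRecord₁₃CoPH F N θ hP) g₀ os (runA₁₃ F K₀ g₀ K) (histA₁₃ θ K₀ g₀ K) (K₀ + K) hU hζm hD t a
    rw [cubeLawOfDatum₉_eq_withDensity F N θ.toStage9Params (datumOfRecord₁₃CoPH F N θ hP) g₀ os (runA₁₃ F K₀ g₀ K) (histA₁₃ θ K₀ g₀ K) (K₀ + K) hU hζm hD t a]
    refine (slotAntiConcentration_gaugeFixed_iff hT U₀ hGm hFi (measurable_cubeStat F N θ.ν (histA₁₃ θ K₀ g₀ K) (K₀ + K) (K₀ + K) hU a) hui).1 ?_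
    refine slotAntiConcentration_withDensity_of_blockFibres (P := F.P (K₀ + K)) (j := K₀ + K) _ (hGm.comp (measurable_fixTo T U₀)) b ((measurable_cubeStat F N θ.ν (histA₁₃ θ K₀ g₀ K) (K₀ + K) (K₀ + K) hU a).comp (measurable_fixTo T U₀)) fun x => ?_
    obtain ⟨S, c, R, U, A, f, D, hS, hSπ, hR, hlaw, hA, hread, hdens, hchart, hDle⟩ := hx x
    have h1 := windowLawAC_of_chartLawAC b hS hSπ c hR (((measurable_cubeStat F N θ.ν (histA₁₃ θ K₀ g₀ K) (K₀ + K) (K₀ + K) hU a).comp (measurable_fixTo T U₀)).fun_comp measurable_updateFinset) hA hread hdens hchart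
    exact slotAntiConcentration_of_law_eq hlaw (slotAntiConcentration_mono (hρA K) hDle h1)
  · refine cubeAC_of_slotAntiConcentration F N θ.toStage9Params (datumOfRecord₁₃CoPH F N θ hP) g₀ os (runB₁₃ F K₀ g₀ K) (histB₁₃ θ K₀ g₀ K) (K₀ + K + 1)
      hU (hw0 _ _) (hρB K) t a (fun s => integrable_topPieceB_of_liveSel K₀ θ hP E hsel hU hζm hζ0 g₀ os K t s)
      (cubeStat F N θ.ν (histB₁₃ θ K₀ g₀ K) (Kc := K₀ + K + 1) (k := K₀ + K + 1) a)
      (fun V => cubeStat_lt_iff F N θ.ν (histB₁₃ θ K₀ g₀ K) (K₀ + K + 1) (K₀ + K + 1) a (plaqInside_cubeEnl_nonempty F θ.ν _ _ _ a) _ V)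
      (fun V => cubeStat_lt_iff F N θ.ν (histB₁₃ θ K₀ g₀ K) (K₀ + K + 1) (K₀ + K + 1) a (plaqInside_cubeEnl_nonempty F θ.ν _ _ _ a) _ V) (hDB K) ?_
    obtain ⟨T, U₀, b, hT, hFi, hui, hx⟩ := htgB K t ht a
    have hGm : Measurable (cubeDensityOfDatum₉ F N θ.toStage9Params (datumOfRecord₁₃CoPH F N θ hP) g₀ os (runB₁₃ F K₀ g₀ K) (histB₁₃ θ K₀ g₀ K) (K₀ + K + 1) t a) :=
      measurable_cubeDensityOfDatum₉ F N θ.toStage9Params (datumOfRecord₁₃CoPH F N θ hP) g₀ os (runB₁₃ F K₀ g₀ K) (histB₁₃ θ K₀ g₀ K) (K₀ + K + 1) hU hζm hD t a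
    rw [cubeLawOfDatum₉_eq_withDensity F N θ.toStage9Params (datumOfRecord₁₃CoPH F N θ hP) g₀ os (runB₁₃ F K₀ g₀ K) (histB₁₃ θ K₀ g₀ K) (K₀ + K + 1) hU hζm hD t a]
    refine (slotAntiConcentration_gaugeFixed_iff hT U₀ hGm hFi (measurable_cubeStat F N θ.ν (histB₁₃ θ K₀ g₀ K) (K₀ + K + 1) (K₀ + K + 1) hU a) hui).1 ?_
    refine slotAntiConcentration_withDensity_of_blockFibres (P := F.P (K₀ + K + 1)) (j := K₀ + K + 1) _ (hGm.comp (measurable_fixTo T U₀)) b ((measurable_cubeStat F N θ.ν (histB₁₃ θ K₀ g₀ K) (K₀ + K + 1) (K₀ + K + 1) hU a).comp (measurable_fixTo T U₀)) fun x => ?_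
    obtain ⟨S, c, R, U, A, f, D, hS, hSπ, hR, hlaw, hA, hread, hdens, hchart, hDle⟩ := hx x
    have h1 := windowLawAC_of_chartLawAC b hS hSπ c hR (((measurable_cubeStat F N θ.ν (histB₁₃ θ K₀ g₀ K) (K₀ + K + 1) (K₀ + K + 1) hU a).comp (measurable_fixTo T U₀)).fun_comp measurable_updateFinset) hA hread hdens hchart
    exact slotAntiConcentration_of_law_eq hlaw (slotAntiConcentration_mono (hρB K) hDle h1)

/-- The V edition at `crOfRecord₁₃VAt` (`Iff.rfl` transfer p598391). [bookkeeping] -/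
theorem shellWeightBound_crOfRecord₁₃VAt_shellSplit_of_treeGaugeChartLaws (K₀ : ℕ) (jcut : ℕ → ℕ) (ρA ρB : WidthLetter₁₃CoPH N) (θ : Stage13HParams F N)
    (hP : θ.Provisos₁₃CoPH F N) (g₀ : ℕ → ℝ) (os : List (ULoop F)) (E : B12.RunParams → ℝ)
    (hsel : θ.ppSel = ppSelLiveOfRecord F N θ.ν θ.τ9 E (wOfRecord₉ F N θ.toStage9Params))
    (hU : LocalBgMeasurable F N θ.ν) (hζm : ZetaMeasurable F N θ.ζ) (hζ0 : ∀ p g k s Pl Ql RS U V', 0 ≤ θ.ζ p g k s Pl Ql RS U V')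
    {DA DB : ℕ → ℝ} (hρA : ∀ K, 0 ≤ ρA F θ hP g₀ os K) (hDA : ∀ K, 0 ≤ DA K) (hρB : ∀ K, 0 ≤ ρB F θ hP g₀ os K) (hDB : ∀ K, 0 ≤ DB K)
    (hsA : Summable (fun K => DA K * ρA F θ hP g₀ os K)) (hsB : Summable (fun K => DB K * ρB F θ hP g₀ os K))
    (htgA : ∀ (K : ℕ) (t : ℝ), |t| ≤ 1 →
      ∀ (a : ↥(cubeIndices (F.P (K₀ + K)) (cubeSide (F.P (K₀ + K)).L θ.ν.M₂ (RkOfRecord (F.P (K₀ + K)).L θ.ν.r (histA₁₃ θ K₀ g₀ K (K₀ + K))) (K₀ + K)))),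
        ∃ (T : Finset (PBond (F.P (K₀ + K)) (K₀ + K))) (U₀ : GaugeField (F.P (K₀ + K)) (K₀ + K) (SU N)) (b : Finset (PBond (F.P (K₀ + K)) (K₀ + K))),
          NoClosedLoop T ∧ GaugeInvariant (cubeDensityOfDatum₉ F N θ.toStage9Params (datumOfRecord₁₃CoPH F N θ hP) g₀ os (runA₁₃ F K₀ g₀ K) (histA₁₃ θ K₀ g₀ K) (K₀ + K) t a) ∧ GaugeInvariant (cubeStat F N θ.ν (histA₁₃ θ K₀ g₀ K) (Kc := K₀ + K) (k := K₀ + K) a) ∧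
          ∀ x : GaugeField (F.P (K₀ + K)) (K₀ + K) (SU N),
            ∃ (S : ℝ) (c : GaugeField (F.P (K₀ + K)) (K₀ + K) (SU N)) (R : (↥b → SU N) → ℝ≥0∞)
              (U : BlockChartSU N b → ℝ) (A : Set (BlockChartSU N b)) (f : BlockChartSU N b → ℝ≥0∞) (D : ℝ),
              0 ≤ S ∧ S ≤ Real.pi ∧ Measurable R ∧
              (Measure.pi fun _ : ↥b => (HaarData.haar : Measure (SU N))).withDensity
                  (fun y => ((cubeDensityOfDatum₉ F N θ.toStage9Params (datumOfRecord₁₃CoPH F N θ hP) g₀ os (runA₁₃ F K₀ g₀ K) (histA₁₃ θ K₀ g₀ K) (K₀ + K) t a) ∘ fixTo T U₀) (Function.updateFinset x b y))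
                = (blockLaw b).withDensity (fun y => windowSU b c S y * R y) ∧
              MeasurableSet A ∧
              (∀ z ∈ closedBall (0 : BlockChartSU N b) S,
                ((cubeStat F N θ.ν (histA₁₃ θ K₀ g₀ K) (Kc := K₀ + K) (k := K₀ + K) a) ∘ fixTo T U₀) (Function.updateFinset x b (expFibreChartSU b c z)) = U z) ∧
              ((fun z : BlockChartSU N b => chartWeightSU b S (expJacWeightSU (kappaSU N)) z * R (expFibreChartSU b c z)) =ᵐ[volume] A.indicator f) ∧
              SlotAntiConcentration (((volume : Measure (BlockChartSU N b)).withDensity f).restrict A) U (epsOfRecord θ.ν (histA₁₃ θ K₀ g₀ K) (K₀ + K)) (ρA F θ hP g₀ os K) D ∧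
              D ≤ DA K)
    (htgB : ∀ (K : ℕ) (t : ℝ), |t| ≤ 1 →
      ∀ (a : ↥(cubeIndices (F.P (K₀ + K + 1)) (cubeSide (F.P (K₀ + K + 1)).L θ.ν.M₂ (RkOfRecord (F.P (K₀ + K + 1)).L θ.ν.r (histB₁₃ θ K₀ g₀ K (K₀ + K + 1))) (K₀ + K + 1)))),
        ∃ (T : Finset (PBond (F.P (K₀ + K + 1)) (K₀ + K + 1))) (U₀ : GaugeField (F.P (K₀ + K + 1)) (K₀ + K + 1) (SU N)) (b : Finset (PBond (F.P (K₀ + K + 1)) (K₀ + K + 1))),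
          NoClosedLoop T ∧ GaugeInvariant (cubeDensityOfDatum₉ F N θ.toStage9Params (datumOfRecord₁₃CoPH F N θ hP) g₀ os (runB₁₃ F K₀ g₀ K) (histB₁₃ θ K₀ g₀ K) (K₀ + K + 1) t a) ∧ GaugeInvariant (cubeStat F N θ.ν (histB₁₃ θ K₀ g₀ K) (Kc := K₀ + K + 1) (k := K₀ + K + 1) a) ∧
          ∀ x : GaugeField (F.P (K₀ + K + 1)) (K₀ + K + 1) (SU N),
            ∃ (S : ℝ) (c : GaugeField (F.P (K₀ + K + 1)) (K₀ + K + 1) (SU N)) (R : (↥b → SU N) → ℝ≥0∞)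
              (U : BlockChartSU N b → ℝ) (A : Set (BlockChartSU N b)) (f : BlockChartSU N b → ℝ≥0∞) (D : ℝ),
              0 ≤ S ∧ S ≤ Real.pi ∧ Measurable R ∧
              (Measure.pi fun _ : ↥b => (HaarData.haar : Measure (SU N))).withDensity
                  (fun y => ((cubeDensityOfDatum₉ F N θ.toStage9Params (datumOfRecord₁₃CoPH F N θ hP) g₀ os (runB₁₃ F K₀ g₀ K) (histB₁₃ θ K₀ g₀ K) (K₀ + K + 1) t a) ∘ fixTo T U₀) (Function.updateFinset x b y))
                = (blockLaw b).withDensity (fun y => windowSU b c S y * R y) ∧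
              MeasurableSet A ∧
              (∀ z ∈ closedBall (0 : BlockChartSU N b) S,
                ((cubeStat F N θ.ν (histB₁₃ θ K₀ g₀ K) (Kc := K₀ + K + 1) (k := K₀ + K + 1) a) ∘ fixTo T U₀) (Function.updateFinset x b (expFibreChartSU b c z)) = U z) ∧
              ((fun z : BlockChartSU N b => chartWeightSU b S (expJacWeightSU (kappaSU N)) z * R (expFibreChartSU b c z)) =ᵐ[volume] A.indicator f) ∧
              SlotAntiConcentration (((volume : Measure (BlockChartSU N b)).withDensity f).restrict A) U (epsOfRecord θ.ν (histB₁₃ θ K₀ g₀ K) (K₀ + K + 1)) (ρB F θ hP g₀ os K) D ∧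
              D ≤ DB K)
    :
    ShellWeightBound (crOfRecord₁₃VAt K₀ jcut (shellSplitOfRecord₁₃At N K₀ ρA ρB) F θ hP g₀ os).l₀
      (crOfRecord₁₃VAt K₀ jcut (shellSplitOfRecord₁₃At N K₀ ρA ρB) F θ hP g₀ os).T (crOfRecord₁₃VAt K₀ jcut (shellSplitOfRecord₁₃At N K₀ ρA ρB) F θ hP g₀ os).A
      (crOfRecord₁₃VAt K₀ jcut (shellSplitOfRecord₁₃At N K₀ ρA ρB) F θ hP g₀ os).B (crOfRecord₁₃VAt K₀ jcut (shellSplitOfRecord₁₃At N K₀ ρA ρB) F θ hP g₀ os).shA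
      (crOfRecord₁₃VAt K₀ jcut (shellSplitOfRecord₁₃At N K₀ ρA ρB) F θ hP g₀ os).shB (crOfRecord₁₃VAt K₀ jcut (shellSplitOfRecord₁₃At N K₀ ρA ρB) F θ hP g₀ os).Wsh :=
  (shellWeightBound_crOfRecord₁₃VAt_iff_crOfRecord₁₃At K₀ jcut (shellSplitOfRecord₁₃At N K₀ ρA ρB) θ hP g₀ os).mpr
    (shellWeightBound_crOfRecord₁₃At_shellSplit_of_treeGaugeChartLaws K₀ jcut ρA ρB θ hP g₀ os E hsel hU hζm hζ0 hρA hDA hρB hDB hsA hsB htgA htgB)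

end AtRecord

end Summit.QuantumFields.YangMills.Theorems.N21ChartJunctionKeyed
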